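import Summits.NavierStokesRegularity.FunctionalMining.StretchingLaminateBurkholderFaces
import Summits.NavierStokesRegularity.FunctionalMining.StretchingLaminateBurkholderLeaf
import Mathlib.Tactic.Linarith
import Mathlib.Tactic.FieldSimp
import HarnessLib

/-!
# FunctionalMining — K1-Q1 laminates, L-CAP-B kernel port (6b): the WEAKEST hypothesis — the concavity clause in `ℝ⁶` alone

search for candidate a priori estimates; no regularity claim.

Cell `pub-nsfunc`, prove seat gen 7.  The files `…BurkholderTree/Leaf/Faces` take the whole vendored named fact
`Burkholder1991_keyFunction` (both printed clauses, every Hilbert space) as hypothesis `hBK`, but USE only its concavity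
clause, and only in `E6 = EuclideanSpace ℝ (Fin 6)`.  So that the laminate cap can be DISCHARGED by proving exactly what is
used, this file types that clause as ONE proposition `Laminate.BurkConcave` (for every `λ > 2` and `x y h k : E6` with
`‖x‖ ≤ 1`, `‖x + h‖ ≤ 1`, `‖k‖ < ‖h‖`, the function `t ↦ u_λ(x + th, y + tk)` is concave on `{t : ‖x + th‖ ≤ 1}` — a concrete
real-analysis statement about the explicit five-piece function `burkholderU`, Burkholder 1991 LNM 1464 §8 (8.11)–(8.16)),
records `Burkholder1991_keyFunction → BurkConcave` (`burkConcave_of_keyFunction`), and re-derives from `BurkConcave` alone the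
chain `(TB)` / dual assembly / chord / case-A finishing lemma (suffix `C`; proofs verbatim from the `hBK` versions).  The cap
file `…BurkholderCap` is built on these, so its headline reads `BurkConcave → C_lam ≤ 49/50`, with the `hBK` form as a
corollary.  `BurkConcave` is a typed HYPOTHESIS (never asserted); proving it (≈ the concavity half of Burkholder's proof of
(8.10)) would make the cap unconditional.  Nothing here concerns Navier–Stokes solutions.
-/

noncomputable section

namespace Summit.NavierStokesRegularity.FunctionalMining

namespace Laminate

open Burk Literature.Probability.Process Filter Topology Finset

/-- **The concavity clause of Burkholder's key function, in `ℝ⁶` (typed hypothesis, NOT asserted).**  For every `λ > 2`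
and `x y h k : E6` with `‖x‖ ≤ 1`, `‖x + h‖ ≤ 1`, `‖k‖ < ‖h‖`, the function `t ↦ u_λ(x + th, y + tk)` is concave on
`I = {t : ‖x + th‖ ≤ 1}` (Burkholder 1991, LNM 1464, §8, "The function `G` is concave on `I`", proof of (8.10)).  This is
exactly what the laminate cap uses of `Burkholder1991_keyFunction`. [ours; typed hypothesis — the dischargeable debt of L-CAP-B] -/
def BurkConcave : Prop :=
  ∀ lam : ℝ, 2 < lam → ∀ x y h k : E6, ‖x‖ ≤ 1 → ‖x + h‖ ≤ 1 → ‖k‖ < ‖h‖ →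
    ConcaveOn ℝ {t : ℝ | ‖x + t • h‖ ≤ 1} (fun t => burkholderU lam (x + t • h) (y + t • k))

/-- The vendored named fact implies the typed clause (its second component, at `E = E6`). [ours; bookkeeping] -/
theorem burkConcave_of_keyFunction (hBK : Burkholder1991_keyFunction) : BurkConcave :=
  fun _lam hlam x y h k hx hxh hk => burk_concaveOn hBK hlam x y h k hx hxh hk

/-- **Two-point (super-split) inequality from concavity**: with weights `l, 1−l` and the `−` child at parameter
`t₂ = −l/(1−l)` on the line through the parent (`t = 0`) and the `+` child (`t = 1`):
`l·u(x + h, y + k) + (1−l)·u(x + t₂h, y + t₂k) ≤ u(x, y)`. [ours; elementary, given `BurkConcave`] -/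
theorem burk_two_pointC (hC : BurkConcave) {lam : ℝ} (hlam : 2 < lam) {l : ℝ} (hl0 : 0 < l)
    (hl1 : l < 1) (x y h k : E6) (hx : ‖x‖ ≤ 1) (hxp : ‖x + h‖ ≤ 1) (hxm : ‖x + (-(l / (1 - l))) • h‖ ≤ 1)
    (hk : ‖k‖ < ‖h‖) :
    l * burkholderU lam (x + h) (y + k)
        + (1 - l) * burkholderU lam (x + (-(l / (1 - l))) • h) (y + (-(l / (1 - l))) • k)
      ≤ burkholderU lam x y := by
  have hc := hC lam hlam x y h k hx hxp hk
  have h1 : (1 : ℝ) ∈ {t : ℝ | ‖x + t • h‖ ≤ 1} := by simpa using hxp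
  have h2 : (-(l / (1 - l))) ∈ {t : ℝ | ‖x + t • h‖ ≤ 1} := hxm
  have key := hc.2 h1 h2 (show (0 : ℝ) ≤ l from hl0.le) (show (0 : ℝ) ≤ 1 - l by linarith) (by ring)
  have ht : l • (1 : ℝ) + (1 - l) • (-(l / (1 - l))) = 0 := by
    simp only [smul_eq_mul]
    have : (1 - l) ≠ 0 := by linarith
    field_simp
    ring
  rw [ht] at key
  simpa [smul_eq_mul] using key

/-- **Super-split inequality for the SCALED node functional** at a div-free split whose node and children satisfy
`|ω|² ≤ M²` (`0 < σ < 1`, `λ > 2`): `λ·u_σ(G₊) + (1−λ)·u_σ(G₋) ≤ u_σ(G)`, `u_σ = burkNodeS λ M σ`.  The scaling makes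
`‖σ²k‖ < ‖σh‖` strict (when `h ≠ 0`; when `h = 0` the three values coincide), so the STRICT concavity clause
`BurkConcave` applies. [ours; given `BurkConcave`] -/
theorem burkNodeS_supersplitC (hC : BurkConcave) {lam : ℝ} (hlam : 2 < lam) {M : ℝ} (hM : 0 < M)
    {σ : ℝ} (hσ0 : 0 < σ) (hσ1 : σ < 1) (G : Grad) (s : Split) (h0 : 0 < s.lam) (h1 : s.lam < 1)
    (hdot : s.dot = 0) (hG : (G.vortSq : ℝ) ≤ M ^ 2) (hGp : ((G.layer (1 - s.lam) s).vortSq : ℝ) ≤ M ^ 2)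
    (hGm : ((G.layer (-s.lam) s).vortSq : ℝ) ≤ M ^ 2) :
    (s.lam : ℝ) * burkNodeS lam M σ (G.layer (1 - s.lam) s)
        + (1 - (s.lam : ℝ)) * burkNodeS lam M σ (G.layer (-s.lam) s)
      ≤ burkNodeS lam M σ G := by
  have hl0 : (0 : ℝ) < s.lam := by exact_mod_cast h0
  have hl1 : (s.lam : ℝ) < 1 := by exact_mod_cast h1
  have h1l : (1 : ℝ) - s.lam ≠ 0 := by linarith
  obtain ⟨x, hx⟩ : ∃ x : E6, x = σ • G.xVec M := ⟨_, rfl⟩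
  obtain ⟨y, hy⟩ : ∃ y : E6, y = σ ^ 2 • G.yVec M := ⟨_, rfl⟩
  obtain ⟨h, hh⟩ : ∃ h : E6, h = (σ * (1 - s.lam)) • s.hVec M := ⟨_, rfl⟩
  obtain ⟨k, hk⟩ : ∃ k : E6, k = (σ ^ 2 * (1 - s.lam)) • s.kVec M := ⟨_, rfl⟩
  have ht : (-((s.lam : ℝ) / (1 - s.lam))) * (σ * (1 - s.lam)) = σ * (((-s.lam : ℚ)) : ℝ) := by
    push_cast; field_simp
  have ht2 : (-((s.lam : ℝ) / (1 - s.lam))) * (σ ^ 2 * (1 - s.lam)) = σ ^ 2 * (((-s.lam : ℚ)) : ℝ) := by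
    push_cast; field_simp
  have hp1 : σ * (1 - (s.lam : ℝ)) = σ * (((1 - s.lam : ℚ)) : ℝ) := by push_cast; ring
  have hp2 : σ ^ 2 * (1 - (s.lam : ℝ)) = σ ^ 2 * (((1 - s.lam : ℚ)) : ℝ) := by push_cast; ring
  -- the three points on the line
  have exP : σ • (G.layer (1 - s.lam) s).xVec M = x + h := by
    rw [Grad.xVec_layer, smul_add, hx, hh, smul_smul, hp1]
  have eyP : σ ^ 2 • (G.layer (1 - s.lam) s).yVec M = y + k := by
    rw [Grad.yVec_layer, smul_add, hy, hk, smul_smul, hp2]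
  have exM : σ • (G.layer (-s.lam) s).xVec M = x + (-((s.lam : ℝ) / (1 - s.lam))) • h := by
    rw [Grad.xVec_layer, smul_add, hx, hh, smul_smul, smul_smul, ht]
  have eyM : σ ^ 2 • (G.layer (-s.lam) s).yVec M = y + (-((s.lam : ℝ) / (1 - s.lam))) • k := by
    rw [Grad.yVec_layer, smul_add, hy, hk, smul_smul, smul_smul, ht2]
  simp only [burkNodeS]
  rw [exP, eyP, exM, eyM, ← hx, ← hy]
  -- norms
  have hx1 : ‖x‖ ≤ 1 := by
    rw [hx, norm_smul, Real.norm_eq_abs, abs_of_pos hσ0]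
    have := norm_xVec_le_one hM G hG
    nlinarith [norm_nonneg (G.xVec M)]
  have hxp : ‖x + h‖ ≤ 1 := by
    rw [← exP, norm_smul, Real.norm_eq_abs, abs_of_pos hσ0]
    have := norm_xVec_le_one hM _ hGp
    nlinarith [norm_nonneg ((G.layer (1 - s.lam) s).xVec M)]
  have hxm : ‖x + (-((s.lam : ℝ) / (1 - s.lam))) • h‖ ≤ 1 := by
    rw [← exM, norm_smul, Real.norm_eq_abs, abs_of_pos hσ0]
    have := norm_xVec_le_one hM _ hGm
    nlinarith [norm_nonneg ((G.layer (-s.lam) s).xVec M)]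
  -- degenerate split: h = 0 (then k = 0 and the three values coincide)
  by_cases hh0 : s.hVec M = 0
  · have hk0 : s.kVec M = 0 := by
      have := Split.norm_kVec_eq M s hdot
      rw [hh0, norm_zero] at this
      exact norm_eq_zero.1 this
    have h0' : h = 0 := by rw [hh, hh0, smul_zero]
    have k0' : k = 0 := by rw [hk, hk0, smul_zero]
    rw [h0', k0']
    simp only [smul_zero, add_zero]
    linarith
  -- generic split: strict subordination after scaling
  have hkh : ‖k‖ < ‖h‖ := by
    rw [hh, hk, norm_smul, norm_smul, Split.norm_kVec_eq M s hdot, Real.norm_eq_abs, Real.norm_eq_abs,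
      abs_of_pos (by positivity), abs_of_pos (by positivity)]
    have hpos : 0 < ‖s.hVec M‖ := norm_pos_iff.2 hh0
    have hσ2 : σ ^ 2 * (1 - (s.lam : ℝ)) < σ * (1 - s.lam) := by
      have : σ ^ 2 < σ := by nlinarith
      exact mul_lt_mul_of_pos_right this (by linarith)
    exact mul_lt_mul_of_pos_right hσ2 hpos
  exact burk_two_pointC hC hlam hl0 hl1 x y h k hx1 hxp hxm hkh

namespace Tree

/-- **(TB) for the scaled functional, down a valid tree**: below a node in state `G` with weight `W ≥ 0` on a valid tree
whose nodes obey `|ω|² ≤ M²` (leaf sup `≤ V = M²`): `Σ_L W_L u_σ(G_L) ≤ W·u_σ(G)` (`0 < σ < 1`). [ours; conditional] -/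
theorem leafSumR_burkNodeS_leC (hC : BurkConcave) {lam : ℝ} (hlam : 2 < lam) {M : ℝ} (hM : 0 < M)
    {σ : ℝ} (hσ0 : 0 < σ) (hσ1 : σ < 1) {V : ℚ} (hV : ((V : ℚ) : ℝ) = M ^ 2) (T : Tree) (hT : T.valid = true) :
    ∀ (G : Grad) (W : ℚ), 0 ≤ W → T.vortSupFrom G ≤ V →
      T.leafSumR (burkNodeS lam M σ) G W ≤ (W : ℝ) * burkNodeS lam M σ G := by
  induction T with
  | leaf => intro G W _ _; simp [leafSumR]
  | node s p m ihp ihm =>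
      intro G W hW hsup
      obtain ⟨h0, h1, hdot, hp, hm⟩ := valid_node hT
      have hc := vortSupFrom_children s p m G
      have hsupP := hc.1.trans hsup
      have hsupM := hc.2.trans hsup
      have cast : ∀ {q : ℚ}, q ≤ V → ((q : ℚ) : ℝ) ≤ M ^ 2 := fun hq => by rw [← hV]; exact_mod_cast hq
      have hvG : (G.vortSq : ℝ) ≤ M ^ 2 := cast ((vortSq_le_vortSupFrom (node s p m) hT G).trans hsup)
      have hvp : ((G.layer (1 - s.lam) s).vortSq : ℝ) ≤ M ^ 2 := cast ((vortSq_le_vortSupFrom p hp _).trans hsupP)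
      have hvm : ((G.layer (-s.lam) s).vortSq : ℝ) ≤ M ^ 2 := cast ((vortSq_le_vortSupFrom m hm _).trans hsupM)
      have hP := ihp hp (G.layer (1 - s.lam) s) (W * s.lam) (mul_nonneg hW h0.le) hsupP
      have hM' := ihm hm (G.layer (-s.lam) s) (W * (1 - s.lam)) (mul_nonneg hW (by linarith)) hsupM
      have hnode := burkNodeS_supersplitC hC hlam hM hσ0 hσ1 G s h0 h1 hdot hvG hvp hvm
      have hWR : (0 : ℝ) ≤ (W : ℝ) := by exact_mod_cast hW
      simp only [leafSumR]
      push_cast at hP hM' ⊢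
      nlinarith [mul_le_mul_of_nonneg_left hnode hWR]

/-- **(TB), scaled, at the root**: `Σ_L W_L u_λ(σ x_L, σ² y_L) ≤ ᾱ_λ` for every valid tree with `M²(𝒯) ≤ V = M²`,
`0 < σ < 1`, `λ > 2`. [ours; given `BurkConcave`] -/
theorem leafSumR_burkNodeS_root_leC (hC : BurkConcave) {lam : ℝ} (hlam : 2 < lam) {M : ℝ} (hM : 0 < M)
    {σ : ℝ} (hσ0 : 0 < σ) (hσ1 : σ < 1) {V : ℚ} (hV : ((V : ℚ) : ℝ) = M ^ 2) (T : Tree) (hT : T.valid = true)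
    (hsup : T.vortSup ≤ V) :
    T.leafSumR (burkNodeS lam M σ) Grad.zero 1 ≤ abar lam := by
  have h := leafSumR_burkNodeS_leC hC hlam hM hσ0 hσ1 hV T hT Grad.zero 1 zero_le_one hsup
  rw [burkNodeS_zero hlam] at h
  simpa using h

/-- **(TB) THE TREE INEQUALITY** (bank K1Q1-LAMINATE-BURKHOLDER §2 (TB); kernel, CONDITIONAL on the Burkholder named
fact): for every valid div-free lamination tree with `M²(𝒯) ≤ V = M²` (`M > 0`) and every `λ > 2`,
`Σ_L W_L u_λ(ω_L/M, √2 S_L/M) ≤ ᾱ_λ = (e²/4)e^{−λ}`.  Proof: the scaled inequality `leafSumR_burkNodeS_root_leC` for every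
`σ ∈ (0,1)` and `σ → 1⁻` leaf by leaf. [ours; given `BurkConcave`] -/
theorem leafSumR_burkNode_root_leC (hC : BurkConcave) {lam : ℝ} (hlam : 2 < lam) {M : ℝ}
    (hM : 0 < M) {V : ℚ} (hV : ((V : ℚ) : ℝ) = M ^ 2) (T : Tree) (hT : T.valid = true) (hsup : T.vortSup ≤ V) :
    T.leafSumR (burkNode lam M) Grad.zero 1 ≤ abar lam := by
  have key : ∀ δ : ℝ, 0 < δ → T.leafSumR (burkNode lam M) Grad.zero 1 ≤ abar lam + δ := by
    intro δ hδ
    have hev := leafSumR_burkNode_eventually_le hlam hM hV T hT hδ Grad.zero 1 zero_le_one hsup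
    have hev2 : ∀ᶠ σ in 𝓝[<] (1 : ℝ), T.leafSumR (burkNodeS lam M σ) Grad.zero 1 ≤ abar lam := by
      filter_upwards [eventually_path_mem] with σ ⟨h0, h1⟩
      exact leafSumR_burkNodeS_root_leC hC hlam hM h0 h1 hV T hT hsup
    obtain ⟨σ, hσ1, hσ2⟩ := (hev.and hev2).exists
    push_cast at hσ1
    linarith
  by_contra hcon
  have hlt : abar lam < T.leafSumR (burkNode lam M) Grad.zero 1 := not_le.1 hcon
  have := key ((T.leafSumR (burkNode lam M) Grad.zero 1 - abar lam) / 2) (by linarith)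
  linarith


end Tree

/-- **THE BURKHOLDER DUAL ASSEMBLY (kernel form of bank THEOREM L-CAP-B, §3 'CONSEQUENCE')**: a pointwise Burkholder leaf
certificate with `c ≥ 0`, `c_k ≥ 0`, `λ_k > 2` bounds the laminate ratio, GIVEN the Burkholder named fact:
`Burkholder1991_keyFunction → LeafClaimB θ a b c λ c_k → RatioBound θ`.  Proof = (au) `ratioBound_of_leafClaim6`
(`Σ W|S_L|² = E`, isometry (I1), Betchov (I2), sextic moment (T6), `Σ W = 1`) plus `(TB)` `Σ_L W_L u_{λ_k}(leaf) ≤ ᾱ_{λ_k}`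
for each threshold. [ours; given `BurkConcave`] -/
theorem ratioBound_of_leafClaimBC (hC : BurkConcave) {θ a b c : ℝ} {n : ℕ} {lam cs : Fin n → ℝ}
    (h : LeafClaimB θ a b c lam cs) (hc : 0 ≤ c) (hcs : ∀ k, 0 ≤ cs k) (hlam : ∀ k, 2 < lam k) :
    RatioBound θ := by
  intro T hT
  have hV0 : 0 ≤ T.vortSup := Tree.vortSup_nonneg T hT
  by_cases hz : T.vortSup = 0
  · have hsup : (T.vortSup : ℝ) ≤ (0 : ℝ) ^ 2 := by rw [hz]; simp
    have hh := Tree.abs_sigma_le_holder T hT le_rfl hsup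
    have hs : (T.sigma : ℝ) ≤ 0 := by
      have := (abs_le.mp hh).2; simpa using this
    have : Real.sqrt (T.vortSup : ℝ) = 0 := by rw [hz]; simp
    rw [this]; linarith
  · have hVpos : 0 < T.vortSup := lt_of_le_of_ne hV0 (Ne.symm hz)
    set M : ℝ := Real.sqrt (T.vortSup : ℝ) with hMdef
    have hM : 0 < M := Real.sqrt_pos.mpr (by exact_mod_cast hVpos)
    have hV : ((T.vortSup : ℚ) : ℝ) = M ^ 2 := by
      rw [hMdef, Real.sq_sqrt (by exact_mod_cast hV0)]
    have hsum := Tree.leafClaimB_sum h hM hV T hT Grad.zero 1 Grad.trace_zero zero_le_one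
      (show T.vortSupFrom Grad.zero ≤ T.vortSup from le_rfl)
    have e1 : T.energy = T.leafSum Grad.sSq Grad.zero 1 := Tree.energy_eq_leafSum_sSq T hT
    have e2 := Tree.leafSum_sSq_sub_half_vortSq T hT Grad.zero 1
    rw [Grad.trSq_zero, mul_zero] at e2
    have e3 := Tree.betchov T hT
    have e4 := Tree.sextic_moment T hT (le_refl T.vortSup)
    have e5 := Tree.leafSum_one T Grad.zero 1
    have e6 : T.sigma = T.leafSum Grad.stretch Grad.zero 1 := by
      simp only [Tree.sigma, Tree.stretchFrom_eq_leafSum]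
    have e1' : (T.energy : ℝ) = (T.leafSum Grad.sSq Grad.zero 1 : ℝ) := by exact_mod_cast e1
    have e2' : (T.leafSum Grad.sSq Grad.zero 1 : ℝ) - (T.leafSum Grad.vortSq Grad.zero 1 : ℝ) / 2 = 0 := by
      exact_mod_cast e2
    have e3q : T.leafSum Grad.symCubeTrace Grad.zero 1 = -(3 / 4) * T.sigma := by linarith [e3]
    have e3' : (T.leafSum Grad.symCubeTrace Grad.zero 1 : ℝ) = -(3 / 4) * (T.sigma : ℝ) := by
      rw [e3q]; push_cast; ring
    have e4' : (T.leafSum (Grad.sexticU T.vortSup) Grad.zero 1 : ℝ) ≤ 1178 * M ^ 6 := by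
      have h4 : ((T.leafSum (Grad.sexticU T.vortSup) Grad.zero 1 : ℚ) : ℝ)
          ≤ ((1178 * T.vortSup ^ 3 : ℚ) : ℝ) := by
        exact_mod_cast e4
      push_cast at h4
      rw [hV] at h4
      calc (T.leafSum (Grad.sexticU T.vortSup) Grad.zero 1 : ℝ) ≤ 1178 * (M ^ 2) ^ 3 := h4
        _ = 1178 * M ^ 6 := by ring
    have e5' : (T.leafSum (fun _ => (1 : ℚ)) Grad.zero 1 : ℝ) = 1 := by exact_mod_cast e5
    have e6' : (T.sigma : ℝ) = (T.leafSum Grad.stretch Grad.zero 1 : ℝ) := by exact_mod_cast e6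
    have hcM : 0 ≤ c / M ^ 3 := div_nonneg hc (pow_nonneg hM.le 3)
    have hlast : c / M ^ 3 * ((T.leafSum (Grad.sexticU T.vortSup) Grad.zero 1 : ℝ)
        - 1178 * M ^ 6 * (T.leafSum (fun _ => (1 : ℚ)) Grad.zero 1 : ℝ)) ≤ 0 := by
      rw [e5', mul_one]
      have := mul_nonneg hcM (show (0 : ℝ) ≤ 1178 * M ^ 6 - (T.leafSum (Grad.sexticU T.vortSup) Grad.zero 1 : ℝ)
        by linarith)
      linarith
    -- the Burkholder terms: each `Σ_L W_L u_k(leaf) − ᾱ_k ≤ 0` by (TB)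
    have hTB : M ^ 3 * ∑ k, cs k * (T.leafSumR (burkNode (lam k) M) Grad.zero 1
        - abar (lam k) * (T.leafSum (fun _ => (1 : ℚ)) Grad.zero 1 : ℝ)) ≤ 0 := by
      have hs : ∑ k, cs k * (T.leafSumR (burkNode (lam k) M) Grad.zero 1
          - abar (lam k) * (T.leafSum (fun _ => (1 : ℚ)) Grad.zero 1 : ℝ)) ≤ 0 := by
        apply Finset.sum_nonpos
        intro k _
        have htb := Tree.leafSumR_burkNode_root_leC hC (hlam k) hM hV T hT le_rfl
        rw [e5', mul_one]
        exact mul_nonpos_of_nonneg_of_nonpos (hcs k) (by linarith)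
      exact mul_nonpos_of_nonneg_of_nonpos (pow_nonneg hM.le 3) hs
    rw [e2', e3', ← e1', ← e6'] at hsum
    linarith [hsum, hlast, hTB]

/-- `Burkholder1991_keyFunction → LeafClaimB θ a b c λ c → … → laminateSupConst ≤ θ`. [ours; conditional] -/
theorem laminateSupConst_le_of_leafClaimBC (hC : BurkConcave) {θ a b c : ℝ} {n : ℕ}
    {lam cs : Fin n → ℝ} (h : LeafClaimB θ a b c lam cs) (hc : 0 ≤ c) (hcs : ∀ k, 0 ≤ cs k)
    (hlam : ∀ k, 2 < lam k) : laminateSupConst ≤ θ :=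
  laminateSupConst_le_of_ratioBound (ratioBound_of_leafClaimBC hC h hc hcs hlam)

/-- **Chord inequality** (clause 2 of the Burkholder named fact with `k = 0`, along a radius): for `0 ≤ r ≤ 1`, `z ≥ 0`,
`(1 − r)·u_λ(0, z) + r·u_λ(1, z) ≤ u_λ(r, z)` — `u_λ(·, z)` lies above the chord from the centre to the sphere.
[ours; given `BurkConcave`] -/
theorem chord_ineqC (hC : BurkConcave) {lam : ℝ} (hlam : 2 < lam) {r z : ℝ} (hr0 : 0 ≤ r)
    (hr1 : r ≤ 1) (hz : 0 ≤ z) : (1 - r) * uProf lam 0 z + r * uProf lam 1 z ≤ uProf lam r z := by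
  obtain ⟨h, hh⟩ : ∃ h : E6, h = WithLp.toLp 2 ![(1 : ℝ), 0, 0, 0, 0, 0] := ⟨_, rfl⟩
  obtain ⟨y, hy⟩ : ∃ y : E6, y = WithLp.toLp 2 ![(0 : ℝ), z, 0, 0, 0, 0] := ⟨_, rfl⟩
  have nh : ‖h‖ = 1 := by
    have h2 : ‖h‖ ^ 2 = 1 := by
      rw [EuclideanSpace.real_norm_sq_eq, hh]; simp [Fin.sum_univ_succ]
    have h0 : 0 ≤ ‖h‖ := norm_nonneg _
    nlinarith [h2, h0]
  have ny : ‖y‖ = z := by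
    have h2 : ‖y‖ ^ 2 = z ^ 2 := by
      rw [EuclideanSpace.real_norm_sq_eq, hy]; simp [Fin.sum_univ_succ]
    have h0 : 0 ≤ ‖y‖ := norm_nonneg _
    exact (sq_eq_sq₀ h0 hz).1 h2
  have hc := hC lam hlam (0 : E6) y h (0 : E6) (by simp) (by simp [nh]) (by simp [nh])
  have h0 : (0 : ℝ) ∈ {t : ℝ | ‖(0 : E6) + t • h‖ ≤ 1} := by simp
  have h1 : (1 : ℝ) ∈ {t : ℝ | ‖(0 : E6) + t • h‖ ≤ 1} := by simp [nh]
  have key := hc.2 h0 h1 (show (0 : ℝ) ≤ 1 - r by linarith) hr0 (by ring)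
  simp only [smul_eq_mul, mul_zero, mul_one, zero_add, zero_smul, smul_zero, add_zero, one_smul] at key
  rw [burkholderU_eq_uProf, burkholderU_eq_uProf, burkholderU_eq_uProf, norm_zero, nh, ny, norm_smul, nh,
    mul_one, Real.norm_eq_abs, abs_of_nonneg hr0] at key
  exact key

/-- **Case A (`B ≥ 0`): the chord reduces the leaf inequality to its two faces.**  With `hΦ0`, `hΦ1` the face bounds at
`(z, s)` (supplied by the certificates of files `…CertF0/F1`), the full inequality at `(r, z, s)` follows from the chord
inequality for each threshold and `B r² ≤ B r`. [ours; given `BurkConcave`, through `chord_ineqC`] -/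
theorem caseA_finishC (hC : BurkConcave) {r z s : ℝ} (hr0 : 0 ≤ r) (hr1 : r ≤ 1) (hz0 : 0 ≤ z)
    (hB : 0 ≤ ((-13843 : ℝ) / 62500) + ((1691 : ℝ) / 2000) * s + ((9 : ℝ) / 10000) * z ^ 2 + ((1 : ℝ) / 100000) * z ^ 4)
    (hΦ0 : ((-309 : ℝ) / 500) * s ^ 3 + ((-2647 : ℝ) / 10000) * z ^ 2 + ((309 : ℝ) / 2000) * z ^ 2 * s + ((-1 : ℝ) / 100000) * z ^ 4 + ((-1 : ℝ) / 2000000) * z ^ 6 + (((49 : ℝ) / 5) * abar (8 : ℝ) + ((266 : ℝ) / 5) * abar (11 : ℝ) + (93 : ℝ) * abar (17 : ℝ) + ((303 : ℝ) / 5) * abar (23 : ℝ)) - (((49 : ℝ) / 5) * uProf (8 : ℝ) 0 z + ((266 : ℝ) / 5) * uProf (11 : ℝ) 0 z + (93 : ℝ) * uProf (17 : ℝ) 0 z + ((303 : ℝ) / 5) * uProf (23 : ℝ) 0 z) ≤ 0)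
    (hΦ1 : ((-309 : ℝ) / 500) * s ^ 3 + ((-2647 : ℝ) / 10000) * z ^ 2 + ((309 : ℝ) / 2000) * z ^ 2 * s + ((-1 : ℝ) / 100000) * z ^ 4 + ((-1 : ℝ) / 2000000) * z ^ 6 + (((-13843 : ℝ) / 62500) + ((1691 : ℝ) / 2000) * s + ((9 : ℝ) / 10000) * z ^ 2 + ((1 : ℝ) / 100000) * z ^ 4) + (((49 : ℝ) / 5) * abar (8 : ℝ) + ((266 : ℝ) / 5) * abar (11 : ℝ) + (93 : ℝ) * abar (17 : ℝ) + ((303 : ℝ) / 5) * abar (23 : ℝ)) - (((49 : ℝ) / 5) * uProf (8 : ℝ) 1 z + ((266 : ℝ) / 5) * uProf (11 : ℝ) 1 z + (93 : ℝ) * uProf (17 : ℝ) 1 z + ((303 : ℝ) / 5) * uProf (23 : ℝ) 1 z) ≤ 0) :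
    (1 - 3 / 4 * ((103 : ℝ) / 500)) * r ^ 2 * s - ((49 : ℝ) / 50) * (z ^ 2 / 2) - ((-1131 : ℝ) / 2500) * (z ^ 2 / 2 - r ^ 2 / 2) - (3 * ((103 : ℝ) / 500) / 2) * s * (2 * s ^ 2 - z ^ 2 / 2) - ((1 : ℝ) / 250000) * ((z ^ 2 / 2) ^ 3 + (10 * (z ^ 2 / 2) ^ 2 + 450 * (z ^ 2 / 2) + 1178) * (1 - r ^ 2) - 1178) - (((49 : ℝ) / 5) * (uProf (8 : ℝ) r z - abar (8 : ℝ)) + ((266 : ℝ) / 5) * (uProf (11 : ℝ) r z - abar (11 : ℝ)) + (93 : ℝ) * (uProf (17 : ℝ) r z - abar (17 : ℝ)) + ((303 : ℝ) / 5) * (uProf (23 : ℝ) r z - abar (23 : ℝ))) ≤ 0 := by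
  have c1 := chord_ineqC hC (by norm_num : (2:ℝ) < 8) hr0 hr1 hz0
  have c2 := chord_ineqC hC (by norm_num : (2:ℝ) < 11) hr0 hr1 hz0
  have c3 := chord_ineqC hC (by norm_num : (2:ℝ) < 17) hr0 hr1 hz0
  have c4 := chord_ineqC hC (by norm_num : (2:ℝ) < 23) hr0 hr1 hz0
  have hr2 : r ^ 2 ≤ r := by nlinarith
  have hBr : (((-13843 : ℝ) / 62500) + ((1691 : ℝ) / 2000) * s + ((9 : ℝ) / 10000) * z ^ 2 + ((1 : ℝ) / 100000) * z ^ 4) * r ^ 2 ≤ (((-13843 : ℝ) / 62500) + ((1691 : ℝ) / 2000) * s + ((9 : ℝ) / 10000) * z ^ 2 + ((1 : ℝ) / 100000) * z ^ 4) * r := mul_le_mul_of_nonneg_left hr2 hB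
  have h1r : 0 ≤ 1 - r := by linarith
  have t0 := mul_nonpos_of_nonneg_of_nonpos h1r hΦ0
  have t1 := mul_nonpos_of_nonneg_of_nonpos hr0 hΦ1
  linarith [c1, c2, c3, c4, hBr, t0, t1]


end Laminate

end Summit.NavierStokesRegularity.FunctionalMining

end
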